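import Literature.Probability.RandomPlanarGeometry.LoewnerImageClock
import HarnessLib

/-!
# The remaining hull and the through-swallow image chain: definitions

Topic `Probability/RandomPlanarGeometry`; definitions + unfolding lemmas. In the proof of the locality of
chordal SLE₆ with respect to a `*`-hull `A` (Lawler–Schramm–Werner (2001) Thm. 2.2; G. F. Lawler (2005),
§6.3 Thm. 6.13, where `Φ_t = g*_t ∘ Φ ∘ g_t⁻¹` is followed up to the time the CURVE leaves the
neighbourhood, through the instants at which the hull swallows whole pieces of `A`) the conformal image is
read through the **remaining hull** `A_t^rem = A ∖ K̂_t` (the part of `A` not yet swallowed by the closed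
hull `K̂_t = Loewner.closedHull W t`). All objects below EXTEND the alive ones of `LoewnerImageFlow` /
`LoewnerImageClock` / `LoewnerImageChain` (there `A` is fixed and `t` is alive, `Disjoint (closedHull W t) A`):
at an alive time `remHull W A t = A` and the `thr`-objects are the alive objects (`*_of_disjoint`). The key
structural fact is `disjoint_closedHull_remHull`: the remaining hull at `t` is missed by ALL closed hulls
`K̂_s`, `s ≤ t`, so on an interval where `remHull W A ·` is constant `= B` the through-swallow objects are the
alive objects of the fixed hull `B` plus constants (`thrImageDriver_eq_imageDriver_remHull`).

* `Loewner.remHull W A t = A ∖ closedHull W t`;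
* `Loewner.thrSlidHull W A t = slidHull W (remHull W A t) t` — `B_t = g_t(A_t^rem) − W_t`;
* `Loewner.thrImageDriver W A t = W_t + L_A − L_{B_t}` — the image driving function `U*_t`;
* `Loewner.thrClockRate`, `Loewner.thrClock`, `Loewner.thrClockInv`, `Loewner.thrClockC` — the capacity clock
  `σ(t) = ∫₀ᵗ Φ'_{B_r}(0)² dr`, its inverse on `[0, σ β]`, and `σ` in `ℝ≥0`;
* `Loewner.thrImageDriverC W A β` — `U*` in capacity time, frozen after `σ β`.

## References

* G. F. Lawler, *Conformally Invariant Processes in the Plane* (2005), §4.6.1 Prop. 4.40–4.41, §6.3 Thm. 6.13. [Lawler2005]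
* G. F. Lawler, O. Schramm, W. Werner, JAMS 16 (2003), §5 (`A_t`, `h_t`, `W̃_t`). [LawlerSchrammWerner2003Restriction]
-/

noncomputable section

open Set Filter Topology Function Complex Metric MeasureTheory
open scoped NNReal

namespace Literature.Probability.RandomPlanarGeometry

namespace Loewner

variable {W : ℝ≥0 → ℝ} {A : Set ℂ}

/-! ### The remaining hull -/

/-- The **remaining hull** `A_t^rem = A ∖ K̂_t`: the part of `A` not yet swallowed by the closed hull.
[cite: Lawler2005, §6.3 Thm. 6.13] -/
def remHull (W : ℝ≥0 → ℝ) (A : Set ℂ) (t : ℝ≥0) : Set ℂ := A \ closedHull W t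

/-- Unfolding of the remaining hull. [folklore] -/
theorem remHull_def (W : ℝ≥0 → ℝ) (A : Set ℂ) (t : ℝ≥0) : remHull W A t = A \ closedHull W t := rfl

/-- The remaining hull is part of `A`. [folklore] -/
theorem remHull_subset (W : ℝ≥0 → ℝ) (A : Set ℂ) (t : ℝ≥0) : remHull W A t ⊆ A := sdiff_subset

/-- **The remaining hull at `t` is missed by every closed hull `K̂_s`, `s ≤ t`.** [folklore] -/
theorem disjoint_closedHull_remHull (W : ℝ≥0 → ℝ) (A : Set ℂ) {s t : ℝ≥0} (hst : s ≤ t) :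
    Disjoint (closedHull W s) (remHull W A t) :=
  Set.disjoint_left.2 fun _ hz hzr ↦ hzr.2 (closedHull_mono W hst hz)

/-- The remaining hull decreases in time. [folklore] -/
theorem remHull_anti (W : ℝ≥0 → ℝ) (A : Set ℂ) : Antitone (remHull W A) :=
  fun _ _ hst _ hz ↦ ⟨hz.1, fun h ↦ hz.2 (closedHull_mono W hst h)⟩

/-- At an alive time the remaining hull is all of `A`. [folklore] -/
theorem remHull_of_disjoint {t : ℝ≥0} (h : Disjoint (closedHull W t) A) : remHull W A t = A :=
  sdiff_eq_left.2 h.symm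

/-! ### The through-swallow slid hull, image driving function and clock -/

/-- The **through-swallow slid hull** `B_t = g_t(A_t^rem) − W_t`.
[cite: LawlerSchrammWerner2003Restriction, §5 (A_t, h_t)] -/
def thrSlidHull (W : ℝ≥0 → ℝ) (A : Set ℂ) (t : ℝ≥0) : Set ℂ := slidHull W (remHull W A t) t

/-- The **through-swallow image driving function** `U*_t = W_t + L_A − L_{B_t}`.
[cite: Lawler2005, §6.3 (U*_t = Φ_t(U_t))] -/
def thrImageDriver (W : ℝ≥0 → ℝ) (A : Set ℂ) (t : ℝ≥0) : ℝ :=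
  W t + (starShift A).re - (starShift (thrSlidHull W A t)).re

/-- The **through-swallow clock rate** `d_r² = Φ'_{B_r}(0)²` (read at `r.toNNReal`). [cite: Lawler2005, Prop. 4.41] -/
def thrClockRate (W : ℝ≥0 → ℝ) (A : Set ℂ) (r : ℝ) : ℝ := starDeriv (thrSlidHull W A r.toNNReal) ^ 2

/-- The **through-swallow capacity clock** `σ(t) = ∫₀ᵗ d_r² dr`. [cite: Lawler2005, Prop. 4.41] -/
def thrClock (W : ℝ≥0 → ℝ) (A : Set ℂ) (t : ℝ) : ℝ := ∫ r in (0 : ℝ)..t, thrClockRate W A r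

/-- The **inverse through-swallow clock** on `[0, σ β]` (a choice of preimage in `[0, β]`). [folklore] -/
def thrClockInv (W : ℝ≥0 → ℝ) (A : Set ℂ) (β : ℝ≥0) (q : ℝ) : ℝ :=
  Function.invFunOn (thrClock W A) (Icc (0 : ℝ) β) q

/-- The **through-swallow image driving function in capacity time** `q ↦ U*_{τ(q ∧ σβ)}` (frozen after
the horizon `σ β`). [cite: Lawler2005, §6.3 (Ũ*_t = U*_{r(t)})] -/
def thrImageDriverC (W : ℝ≥0 → ℝ) (A : Set ℂ) (β : ℝ≥0) (q : ℝ≥0) : ℝ :=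
  thrImageDriver W A (thrClockInv W A β (min (q : ℝ) (thrClock W A β))).toNNReal

/-- The through-swallow capacity clock in `ℝ≥0`. [folklore] -/
def thrClockC (W : ℝ≥0 → ℝ) (A : Set ℂ) (t : ℝ≥0) : ℝ≥0 := (thrClock W A t).toNNReal

/-! ### Unfolding and consistency with the alive objects -/

/-- `σ 0 = 0`. [folklore] -/
@[simp] theorem thrClock_zero (W : ℝ≥0 → ℝ) (A : Set ℂ) : thrClock W A 0 = 0 := by simp [thrClock]

/-- `0 < d_r² ≤ 1` for every `r` (the canonical derivative of any set lies in `(0, 1]`). [folklore] -/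
theorem thrClockRate_pos_le_one (W : ℝ≥0 → ℝ) (A : Set ℂ) (r : ℝ) :
    0 < thrClockRate W A r ∧ thrClockRate W A r ≤ 1 := by
  obtain ⟨h0, h1⟩ := starDeriv_pos_le_one (thrSlidHull W A r.toNNReal)
  exact ⟨by rw [thrClockRate]; positivity, by rw [thrClockRate]; exact pow_le_one₀ h0.le h1⟩

/-- Consistency with the alive objects: slid hull. [folklore] -/
theorem thrSlidHull_of_disjoint {t : ℝ≥0} (h : Disjoint (closedHull W t) A) :
    thrSlidHull W A t = slidHull W A t := by rw [thrSlidHull, remHull_of_disjoint h]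

/-- Consistency with the alive objects: image driving function. [folklore] -/
theorem thrImageDriver_of_disjoint {t : ℝ≥0} (h : Disjoint (closedHull W t) A) :
    thrImageDriver W A t = imageDriver W A t := by
  rw [thrImageDriver, thrSlidHull_of_disjoint h, imageDriver]

/-- Consistency with the alive objects: clock rate. [folklore] -/
theorem thrClockRate_of_disjoint {r : ℝ} (h : Disjoint (closedHull W r.toNNReal) A) :
    thrClockRate W A r = imageClockRate W A r := by
  rw [thrClockRate, thrSlidHull_of_disjoint h, imageClockRate]

/-- Consistency with the alive objects: clock, up to an alive time `β`. [folklore] -/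
theorem thrClock_of_disjoint {β : ℝ≥0} (h : Disjoint (closedHull W β) A) {t : ℝ} (ht : t ∈ Icc (0 : ℝ) β) :
    thrClock W A t = imageClock W A t := by
  rw [thrClock, imageClock]
  refine intervalIntegral.integral_congr fun r hr ↦ ?_
  rw [uIcc_of_le ht.1] at hr
  refine thrClockRate_of_disjoint (alive_mono ?_ h)
  rw [← NNReal.coe_le_coe, Real.coe_toNNReal _ hr.1]
  exact hr.2.trans ht.2

/-- **Piecewise structure**: if the remaining hull is the same at `t` and at `t'`, then at `t` the
through-swallow driving function is the ALIVE image driving function of the fixed hull `remHull W A t'`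
plus the constant `L_A − L_{A^rem}` (that hull being missed by `K̂_t` when `t ≤ t'`,
`disjoint_closedHull_remHull`). [folklore] -/
theorem thrImageDriver_eq_imageDriver_remHull {t t' : ℝ≥0} (h : remHull W A t = remHull W A t') :
    thrImageDriver W A t = imageDriver W (remHull W A t') t +
      ((starShift A).re - (starShift (remHull W A t')).re) := by
  rw [thrImageDriver, thrSlidHull, h, imageDriver]; ring

/-- Piecewise structure of the slid hull. [folklore] -/
theorem thrSlidHull_eq_slidHull_remHull {t t' : ℝ≥0} (h : remHull W A t = remHull W A t') :
    thrSlidHull W A t = slidHull W (remHull W A t') t := by rw [thrSlidHull, h]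

/-- Piecewise structure of the clock rate. [folklore] -/
theorem thrClockRate_eq_imageClockRate_remHull {r : ℝ} {t' : ℝ≥0} (h : remHull W A r.toNNReal = remHull W A t') :
    thrClockRate W A r = imageClockRate W (remHull W A t') r := by
  rw [thrClockRate, thrSlidHull_eq_slidHull_remHull h, imageClockRate]

end Loewner

end Literature.Probability.RandomPlanarGeometry

end
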